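import Mathlib
import HarnessLib

/-!
# The linear isometry determined by Gram data

A standard Hilbert-space lemma (the "model" or "lurking isometry" construction, e.g.
Akhiezer–Glazman §I.12, de Branges 1968 proof of Thm. 21; used by Kac–Kreĭn 1974 §10 to build the
spectral transform of a string from its Weyl solutions): if two families `x : ι → E`, `k : ι → F`
in Hilbert spaces have the same Gram matrix, `⟪xᵢ, xⱼ⟫_𝕜 = ⟪kᵢ, kⱼ⟫_𝕜`, then there is a bounded linear
map `T : E → F` with `T xᵢ = kᵢ` which is isometric on the closed span `X̄` of the `xᵢ` and
vanishes on its orthogonal complement: `T = T ∘ P_{X̄}` and `‖T v‖ = ‖P_{X̄} v‖`.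

Everything here is PROVED; no named facts.
-/

open Submodule
open scoped InnerProductSpace

noncomputable section

namespace Literature.Analysis.InnerProduct

variable {𝕜 : Type*} [RCLike 𝕜] {E F : Type*} [NormedAddCommGroup E] [InnerProductSpace 𝕜 E]
  [NormedAddCommGroup F] [InnerProductSpace 𝕜 F] {ι : Type*}

/-- Equality of Gram matrices gives equality of all inner products of finite linear combinations.
[folklore] -/
theorem inner_linearCombination_eq (x : ι → E) (k : ι → F) (h : ∀ i j, ⟪x i, x j⟫_𝕜 = ⟪k i, k j⟫_𝕜)
    (c d : ι →₀ 𝕜) :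
    ⟪Finsupp.linearCombination 𝕜 x c, Finsupp.linearCombination 𝕜 x d⟫_𝕜 =
      ⟪Finsupp.linearCombination 𝕜 k c, Finsupp.linearCombination 𝕜 k d⟫_𝕜 := by
  simp only [Finsupp.linearCombination_apply, Finsupp.sum, sum_inner, inner_sum, inner_smul_left,
    inner_smul_right, h]

/-- Equality of Gram matrices gives equality of norms of finite linear combinations. [folklore] -/
theorem norm_linearCombination_eq (x : ι → E) (k : ι → F) (h : ∀ i j, ⟪x i, x j⟫_𝕜 = ⟪k i, k j⟫_𝕜)
    (c : ι →₀ 𝕜) : ‖Finsupp.linearCombination 𝕜 x c‖ = ‖Finsupp.linearCombination 𝕜 k c‖ := by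
  have h1 := inner_linearCombination_eq x k h c c
  rw [inner_self_eq_norm_sq_to_K, inner_self_eq_norm_sq_to_K] at h1
  have h2 : (‖Finsupp.linearCombination 𝕜 x c‖ : ℝ) ^ 2 = ‖Finsupp.linearCombination 𝕜 k c‖ ^ 2 := by
    exact_mod_cast h1
  nlinarith [norm_nonneg (Finsupp.linearCombination 𝕜 x c), norm_nonneg (Finsupp.linearCombination 𝕜 k c),
    sq_nonneg (‖Finsupp.linearCombination 𝕜 x c‖ - ‖Finsupp.linearCombination 𝕜 k c‖),
    sq_nonneg (‖Finsupp.linearCombination 𝕜 x c‖ + ‖Finsupp.linearCombination 𝕜 k c‖)]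

/-- **The isometry on the (non-closed) span.** [folklore] -/
theorem exists_linearIsometry_span (x : ι → E) (k : ι → F) (h : ∀ i j, ⟪x i, x j⟫_𝕜 = ⟪k i, k j⟫_𝕜) :
    ∃ W₀ : span 𝕜 (Set.range x) →ₗᵢ[𝕜] F, ∀ i,
      W₀ ⟨x i, subset_span (Set.mem_range_self i)⟩ = k i := by
  set V₀ : (ι →₀ 𝕜) →ₗ[𝕜] E := Finsupp.linearCombination 𝕜 x with hV₀
  set U₀ : (ι →₀ 𝕜) →ₗ[𝕜] F := Finsupp.linearCombination 𝕜 k with hU₀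
  have hker : LinearMap.ker V₀ ≤ LinearMap.ker U₀ := by
    intro c hc
    rw [LinearMap.mem_ker] at hc ⊢
    have := norm_linearCombination_eq x k h c
    rw [← norm_eq_zero]
    change ‖Finsupp.linearCombination 𝕜 k c‖ = 0
    rw [← this]
    change ‖V₀ c‖ = 0
    rw [hc, norm_zero]
  -- `U₀` descends to the quotient by `ker V₀`, which is the range of `V₀`
  set W₁ : LinearMap.range V₀ →ₗ[𝕜] F := ((LinearMap.ker V₀).liftQ U₀ hker).comp
    (LinearMap.quotKerEquivRange V₀).symm.toLinearMap with hW₁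
  have hW₁ : ∀ c : ι →₀ 𝕜, W₁ ⟨V₀ c, LinearMap.mem_range_self V₀ c⟩ = U₀ c := by
    intro c
    simp only [hW₁, LinearMap.comp_apply, LinearEquiv.coe_toLinearMap]
    rw [LinearMap.quotKerEquivRange_symm_apply_image V₀ c (LinearMap.mem_range_self V₀ c)]
    rfl
  have hrange : LinearMap.range V₀ = span 𝕜 (Set.range x) := by
    rw [hV₀, Finsupp.range_linearCombination]
  -- isometry of `W₁`
  have hnorm : ∀ y : LinearMap.range V₀, ‖W₁ y‖ = ‖y‖ := by
    rintro ⟨y, hy⟩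
    obtain ⟨c, rfl⟩ := LinearMap.mem_range.1 hy
    rw [hW₁ c]
    exact (norm_linearCombination_eq x k h c).symm
  let W₂ : LinearMap.range V₀ →ₗᵢ[𝕜] F := ⟨W₁, hnorm⟩
  -- transport along `range V₀ = span`
  refine ⟨W₂.comp (LinearIsometryEquiv.ofEq _ _ hrange.symm).toLinearIsometry, fun i => ?_⟩
  simp only [LinearIsometry.coe_comp, Function.comp_apply]
  have hxi : x i = V₀ (Finsupp.single i 1) := by simp [hV₀]
  have : (LinearIsometryEquiv.ofEq (span 𝕜 (Set.range x)) (LinearMap.range V₀) hrange.symm).toLinearIsometry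
      ⟨x i, subset_span (Set.mem_range_self i)⟩ =
      ⟨V₀ (Finsupp.single i 1), LinearMap.mem_range_self V₀ _⟩ := by
    ext; exact hxi
  rw [this]
  rw [show W₂ ⟨V₀ (Finsupp.single i 1), LinearMap.mem_range_self V₀ _⟩ =
    W₁ ⟨V₀ (Finsupp.single i 1), LinearMap.mem_range_self V₀ _⟩ from rfl, hW₁]
  simp [hU₀]


variable [CompleteSpace E] [CompleteSpace F]

/-- **The linear map determined by Gram data** ("lurking isometry"): `T xᵢ = kᵢ`, `T` is an
isometry on the closed span `X̄` of the `xᵢ`, and `T = T ∘ P_{X̄}`. [folklore] -/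
theorem exists_clm_of_gram_eq (x : ι → E) (k : ι → F) (h : ∀ i j, ⟪x i, x j⟫_𝕜 = ⟪k i, k j⟫_𝕜) :
    ∃ T : E →L[𝕜] F, (∀ i, T (x i) = k i) ∧
      (∀ v ∈ (span 𝕜 (Set.range x)).topologicalClosure, ‖T v‖ = ‖v‖) ∧
      (∀ v, T v = T ((span 𝕜 (Set.range x)).topologicalClosure.starProjection v)) := by
  set X : Submodule 𝕜 E := span 𝕜 (Set.range x) with hX
  set Xc : Submodule 𝕜 E := X.topologicalClosure with hXc
  haveI : CompleteSpace Xc := (Submodule.isClosed_topologicalClosure X).completeSpace_coe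
  obtain ⟨W₀, hW₀⟩ := exists_linearIsometry_span x k h
  -- the dense isometric inclusion `X → X̄`
  have hle : X ≤ Xc := X.le_topologicalClosure
  let e' : X →ₗᵢ[𝕜] Xc := ⟨Submodule.inclusion hle, fun _ => rfl⟩
  let e : X →L[𝕜] Xc := e'.toContinuousLinearMap
  have he_dense : DenseRange e := by
    have h1 : DenseRange (Set.inclusion (show (X : Set E) ⊆ (Xc : Set E) from hle)) := by
      rw [denseRange_inclusion_iff]
      rw [hXc, Submodule.topologicalClosure_coe]
    exact h1
  have he_ui : IsUniformInducing e := e'.isometry.isUniformInducing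
  -- extend `W₀` to `X̄`
  let W : Xc →L[𝕜] F := (W₀.toContinuousLinearMap).extend e
  have hWe : ∀ v : X, W (e v) = W₀ v := fun v =>
    ContinuousLinearMap.extend_eq (W₀.toContinuousLinearMap) he_dense he_ui v
  have hWnorm : ∀ v : Xc, ‖W v‖ = ‖v‖ := by
    intro v
    refine he_dense.induction_on v (isClosed_eq (continuous_norm.comp W.continuous) continuous_norm) ?_
    intro u
    rw [hWe u, LinearIsometry.coe_toContinuousLinearMap, W₀.norm_map]
    rfl
  -- the final map
  have hproj_mem : ∀ {v : E} (hv : v ∈ Xc), Xc.orthogonalProjectionOnto v = ⟨v, hv⟩ := fun {v} hv =>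
    Xc.orthogonalProjectionOnto_mem_subspace_eq_self ⟨v, hv⟩
  refine ⟨W ∘L Xc.orthogonalProjectionOnto, fun i => ?_, fun v hv => ?_, fun v => ?_⟩
  · have hxi : x i ∈ Xc := hle (subset_span (Set.mem_range_self i))
    simp only [ContinuousLinearMap.coe_comp, Function.comp_apply]
    have : (⟨x i, hxi⟩ : Xc) = e ⟨x i, subset_span (Set.mem_range_self i)⟩ := rfl
    rw [hproj_mem hxi, this, hWe, hW₀]
  · simp only [ContinuousLinearMap.coe_comp, Function.comp_apply]
    rw [hWnorm, hproj_mem hv]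
    rfl
  · simp only [ContinuousLinearMap.coe_comp, Function.comp_apply]
    congr 1
    rw [Submodule.starProjection_apply, hproj_mem (Xc.orthogonalProjectionOnto v).2]

omit [CompleteSpace E] [CompleteSpace F] in
/-- Consequences: `‖T v‖ = ‖P_{X̄} v‖ ≤ ‖v‖` and `⟪T v, T w⟫_𝕜 = ⟪P_{X̄} v, P_{X̄} w⟫_𝕜`. [folklore] -/
theorem norm_and_inner_of_gram {T : E →L[𝕜] F} {X : Submodule 𝕜 E} [X.HasOrthogonalProjection]
    (hiso : ∀ v ∈ X, ‖T v‖ = ‖v‖) (hproj : ∀ v, T v = T (X.starProjection v)) :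
    (∀ v, ‖T v‖ = ‖X.starProjection v‖) ∧ (∀ v, ‖T v‖ ≤ ‖v‖) ∧
      ∀ v w, ⟪T v, T w⟫_𝕜 = ⟪X.starProjection v, X.starProjection w⟫_𝕜 := by
  have h1 : ∀ v, ‖T v‖ = ‖X.starProjection v‖ := fun v => by
    rw [hproj v, hiso _ (X.starProjection_apply_mem v)]
  refine ⟨h1, fun v => (h1 v).trans_le (X.norm_starProjection_apply_le v), fun v w => ?_⟩
  -- the restriction of `T` to `X` is a linear isometry, hence preserves inner products
  let Tx : X →ₗᵢ[𝕜] F := ⟨T.toLinearMap.comp X.subtype, fun u => hiso u u.2⟩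
  have := Tx.inner_map_map (X.orthogonalProjectionOnto v) (X.orthogonalProjectionOnto w)
  rw [hproj v, hproj w, Submodule.starProjection_apply, Submodule.starProjection_apply]
  exact this

end Literature.Analysis.InnerProduct

end
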